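import Mathlib.NumberTheory.NumberField.Basic
import Mathlib.RingTheory.Localization.Integral
import Mathlib.RingTheory.Adjoin.Polynomial.Basic
import HarnessLib

/-!
# Every algebraic integer of `K = ℚ(α)` has a multiple in `ℤ[α]`

For a number field `K` generated over `ℚ` by an algebraic integer `α ∈ 𝓞_K` (`ℚ[α] = K`), the
order `ℤ[α]` has finite index in `𝓞_K`; elementwise: **for every `r ∈ 𝓞_K` there are an integer
`m ≠ 0` and `p ∈ ℤ[T]` with `m r = p(α)`** (write `r = q(α)` with `q ∈ ℚ[T]` and clear the
denominators of `q`, Mathlib `IsLocalization.integerNormalization`). This is the standard remark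
that `ℤ[α] ⊆ 𝓞_K` are both lattices of full rank in `K` (Neukirch, *Algebraic Number Theory*,
Ch. I §2, proof of Prop. 2.10 / (2.9): `d 𝓞_K ⊆ ℤ[α]`-type inclusions; Marcus, *Number Fields*,
Ch. 2, Thm. 9 and its corollary).

* `NumberField.RingOfIntegers.exists_natCast_mul_eq_aeval` — the statement above, in `𝓞 K`.

It is the hypothesis `hgen` of the equivariant Poincaré complements for CM orders
(`Motives/AbelianVarietyPoincareEquivariantPolynomial.comp_eq_comp_of_nsmul_generator`,
`Motives/AbelianVarietyPoincareEquivariantPerfectField.exists_equivariant_complement_of_generator`)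
for the maximal order `R = 𝓞_K` acting by complex multiplication. Everything is proved; no
definition, no named fact (D-0026).

## References

* J. Neukirch, *Algebraic Number Theory*, Grundlehren 322 (1999), Ch. I §2 (integral bases;
  `ℤ[α]` of finite index in `𝓞_K`). [NeukirchANT1999]
-/

noncomputable section

open Polynomial
open scoped Polynomial nonZeroDivisors NumberField

namespace NumberField.RingOfIntegers

/-- **Every algebraic integer of `ℚ(α)` has a non-zero integer multiple in `ℤ[α]`**: for a number
field `K` with `ℚ[α] = K` for some `α ∈ 𝓞_K`, every `r ∈ 𝓞_K` satisfies `m r = p(α)` for some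
`m ∈ ℕ`, `m ≠ 0`, and `p ∈ ℤ[T]`. [cite: NeukirchANT1999, Ch. I §2 (Prop. 2.10 and (2.9))] -/
theorem exists_natCast_mul_eq_aeval {K : Type*} [Field K] [NumberField K] (α : 𝓞 K)
    (hα : Algebra.adjoin ℚ {(α : K)} = ⊤) (r : 𝓞 K) :
    ∃ (m : ℕ) (p : ℤ[X]), m ≠ 0 ∧ (m : 𝓞 K) * r = aeval α p := by
  -- `r = q(α)` with `q ∈ ℚ[T]`
  have hr : (r : K) ∈ Algebra.adjoin ℚ {(α : K)} := by rw [hα]; exact Algebra.mem_top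
  rw [Algebra.adjoin_singleton_eq_range_aeval] at hr
  obtain ⟨q, hq⟩ := hr
  -- clear denominators: `q'.map = d • q`, `d ≠ 0`
  obtain ⟨d, hd, hq'⟩ := IsLocalization.integerNormalization_spec ℤ⁰ q
  have hd0 : d ≠ 0 := nonZeroDivisors.ne_zero hd
  refine ⟨d.natAbs, C d.sign * IsLocalization.integerNormalization ℤ⁰ q, Int.natAbs_ne_zero.2 hd0, ?_⟩
  apply RingOfIntegers.coe_injective
  -- compare in `K`: `q'(α) = d • q(α) = d r` and `natAbs d = sign d * d`
  have hq2 : aeval (algebraMap (𝓞 K) K α) q = algebraMap (𝓞 K) K r := hq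
  have e2 : aeval (algebraMap (𝓞 K) K α) (IsLocalization.integerNormalization ℤ⁰ q) =
      (d : K) * algebraMap (𝓞 K) K r := by
    rw [← aeval_map_algebraMap ℚ (algebraMap (𝓞 K) K α), hq', map_zsmul, hq2, zsmul_eq_mul]
  have e3 : ((d.natAbs : ℕ) : K) = (d.sign : K) * (d : K) := by
    rw [← Int.cast_natCast, ← Int.sign_mul_self_eq_natAbs, Int.cast_mul]
  change algebraMap (𝓞 K) K _ = algebraMap (𝓞 K) K _
  rw [map_mul, map_natCast, ← aeval_algebraMap_apply, map_mul, aeval_C, e2, eq_intCast, e3,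
    mul_assoc]

end NumberField.RingOfIntegers
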